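import Literature.NumberTheory.EllipticCurves.Rank1Residual.CyclotomicWindingSpan
import Summits.BirchSwinnertonDyer.BirchSwinnertonDyer.Theorems.ConjSpanGenAllLevels
import Literature.NumberTheory.Automorphic.CongruenceSubgroupPropertySL2AwayHolds

/-!
# Crux `OrdKatoHalfAtTwoIso` (stmt-BirchSwinnertonDyer-19573) — card `horocycle-span-mod-two`, GEN-5 status
# correction (pen RC-250 (E)): the uniform criterion of the card is a COROLLARY of THEOREM B.

Planner sketch (crux-ideate, ideator 1, gen 5).  No `sorry`, no new axiom, nothing about any curve; BSD is
NOT proved by any of this.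

`TwoPowerHorocycleCriterion'` is the card's criterion (HC₂)_N in the GENERATION-MATCHING form (the
hypothesis «κ kills finite-order elements» replaces «κ kills every |tr| ≤ 2 element»; the two forms agree by
the classical fact that torsion elements of `SL(2,ℤ)` have `|tr| ≤ 2`, and the bridge to cusp half-integrality
only ever used this form).  `criterion'_of_conjSpanGen` derives it from
`Literature…Rank1Residual.ConjSpanGen N 2` in a few lines (κ kills `spanGenerators N 2` by hypothesis and
the commutator subgroup because its target is abelian, hence kills `spanSubgroup N 2 ⊇ Γ₁(N)`; so κ factors
through `Gamma0Map N : Γ₀(N) →* ZMod N`, `γ ↦ d mod N`), and `criterion'_of_odd` feeds it THEOREM B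
(`ConjSpanGenAllLevels.conjSpanGenAll_of_vaserstein_away` + `SL2Rel.Away.relG_le_relE_span_natCast`,
= `PrintX8VSConjSpanGenAll.conjSpanGen_holds`, imported route-free): (HC₂')_N holds for EVERY odd `N`.
-/

namespace Summit.BirchSwinnertonDyer.BirchSwinnertonDyer.Cruxes.OrdKatoHalfAtTwoIso.ResidualMuTransport

open CongruenceSubgroup Literature.NumberTheory.EllipticCurves.Rank1Residual

/-- (HC₂')_N — the `2`-power horocycle criterion, generation-matching form: every character
`κ : Γ₀(N) → ℤ/2` killing the finite-order elements, the trace-`±2` elements and the `2`-good elements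
(`|d| = 2ⁿ`) is a function of `d mod N`. -/
def TwoPowerHorocycleCriterion' (N : ℕ) : Prop :=
  ∀ κ : Gamma0 N →* Multiplicative (ZMod 2),
    (∀ γ : Gamma0 N, IsOfFinOrder γ → κ γ = 1) →
    (∀ γ : Gamma0 N, trEntry γ = 2 ∨ trEntry γ = -2 → κ γ = 1) →
    (∀ γ : Gamma0 N, IsGoodAt 2 γ → κ γ = 1) →
    ∃ χ : ZMod N → Multiplicative (ZMod 2), ∀ γ : Gamma0 N, κ γ = χ (Gamma0Map N γ)

/-- `ConjSpanGen N 2 ⟹ (HC₂')_N`. -/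
theorem criterion'_of_conjSpanGen {N : ℕ} (h : ConjSpanGen N 2) : TwoPowerHorocycleCriterion' N := by
  intro κ hfin htr hgood
  -- κ kills the span subgroup: generators by hypothesis, commutators because the target is abelian
  have hker : spanSubgroup N 2 ≤ κ.ker := by
    rw [spanSubgroup]
    refine sup_le ?_ (Abelianization.commutator_subset_ker κ)
    rw [Subgroup.closure_le]
    intro γ hγ
    simp only [spanGenerators, Set.mem_setOf_eq] at hγ
    rw [SetLike.mem_coe, MonoidHom.mem_ker]
    rcases hγ with hg | hf | ht | ht
    · exact hgood γ hg
    · exact hfin γ hf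
    · exact htr γ (Or.inl ht)
    · exact htr γ (Or.inr ht)
  -- hence κ kills Γ₁(N) ⊆ Γ_H(N) ⊆ spanSubgroup
  have hΓ₁ : ∀ γ : Gamma0 N, γ ∈ Gamma1' N → κ γ = 1 := fun γ hγ =>
    (MonoidHom.mem_ker).1 (hker ((conjSpanGen_iff_gamma1 N 2).1 h γ hγ))
  classical
  refine ⟨fun x => if hx : ∃ γ : Gamma0 N, Gamma0Map N γ = x then κ hx.choose else 1, fun γ => ?_⟩
  have hx : ∃ γ' : Gamma0 N, Gamma0Map N γ' = Gamma0Map N γ := ⟨γ, rfl⟩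
  dsimp only
  rw [dif_pos hx]
  set c : Gamma0 N := hx.choose with hc_def
  have hc : Gamma0Map N c = Gamma0Map N γ := hx.choose_spec
  -- `γ c⁻¹ ∈ Γ₁(N)`: its `d`-entry is `1 mod N`
  have e1 : Gamma0Map N (γ * c⁻¹) * Gamma0Map N c = Gamma0Map N γ := by
    rw [← map_mul, inv_mul_cancel_right]
  have e2 : Gamma0Map N c * Gamma0Map N c⁻¹ = 1 := by
    rw [← map_mul, mul_inv_cancel, map_one]
  have hmem : γ * c⁻¹ ∈ Gamma1' N := by
    rw [Gamma1_mem']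
    calc Gamma0Map N (γ * c⁻¹)
        = Gamma0Map N (γ * c⁻¹) * (Gamma0Map N c * Gamma0Map N c⁻¹) := by rw [e2, mul_one]
      _ = Gamma0Map N γ * Gamma0Map N c⁻¹ := by rw [← mul_assoc, e1]
      _ = Gamma0Map N c * Gamma0Map N c⁻¹ := by rw [hc]
      _ = 1 := e2
  have hκ : κ (γ * c⁻¹) = 1 := hΓ₁ _ hmem
  rw [map_mul, map_inv, mul_inv_eq_one] at hκ
  exact hκ

/-- (HC₂')_N for every odd level `N`, from THEOREM B of the tree (route-free form). -/
theorem criterion'_of_odd (N : ℕ) (hN : ¬ 2 ∣ N) : TwoPowerHorocycleCriterion' N :=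
  criterion'_of_conjSpanGen
    (Summit.BirchSwinnertonDyer.BirchSwinnertonDyer.Theorems.ConjSpanGenAllLevels.conjSpanGenAll_of_vaserstein_away
      Literature.NumberTheory.Automorphic.SL2Rel.Away.relG_le_relE_span_natCast N 2 Nat.prime_two hN)

end Summit.BirchSwinnertonDyer.BirchSwinnertonDyer.Cruxes.OrdKatoHalfAtTwoIso.ResidualMuTransport
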